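import Summits.Langlands.Langlands.Theorems.ExtendedAdequacySplitCoreIrreducibleProductLiftingStubProductDescentTransport
import Summits.Langlands.Langlands.Theorems.IrreducibilityBySelfDualityIrreducibleOffSectorConstituents
import Summits.Langlands.Langlands.Theorems.IrreducibilityBySelfDualityIrreducibleOffSectorFrameDevissage
import Summits.Langlands.Langlands.Theorems.IrreducibilityBySelfDualityIrreducibleOffSectorDeRhamBlocks
import Literature.NumberTheory.GaloisRepresentations.ToLocalRestrictField
import Literature.NumberTheory.GaloisRepresentations.FramedRepBlockSum
import Literature.NumberTheory.GaloisRepresentations.InducedAEUnramified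
import Literature.NumberTheory.PAdicHodge.DeRhamBaseChangeProofs

/-!
# CPR `ExtendedAdequacySplit.CoreIrreducibleProductLifting` (stmt-Langlands-27081), line `birth`, stub 1/5
# `stub_productDescentTransport` (T_Π) — part 2: the IRREDUCIBLE-CASE reduction (¬SolvablyReducible is used)

Part 1 (`…StubProductDescentTransport`, landed) proves T_Π from the two functorialities `Sym² ⊗ χ` / `⊠` in CONSTITUENT form (no
hypothesis on `r = ρ|_E`; the functoriality must then handle dihedral `σ`, i.e. reducible `Sym² σ`, by automorphic induction).  This file
proves the sharper reduction the crux actually needs: in CPR's box `ρ|_E` is IRREDUCIBLE for every finite solvable Galois `E/K`, because CPR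
carries the binder `¬ BrightMate.SolvablyReducible ρ` and — THIS IS PROVED HERE, for every geometric `ρ` — a reducible `ρ|_E` has an
irreducible GEOMETRIC trace-constituent of rank `0 < m < n` with a framed complement (`exists_irreducible_geometric_traceConstituent`: strong
induction on the rank by the landed continuous frame dévissage `IrreducibleOffSector.stub_frameDevissage`, de Rham-ness of the diagonal blocks
`stub_deRhamBlocks` (Fontaine, Exp. III Prop. 1.5.2), unramifiedness of the blocks `blocks_eq_one_of_eq_one`, additivity of traces along a block
triangular frame, and the landed block sum `FramedRep.blockSum` for the complement; geometricity of `ρ|_E` itself is the landed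
`FramedGaloisRep.eventually_isUnramifiedAt_restrictField` + `isDeRhamFramed_toLocal_restrictField DeRhamBaseChange_holds`, Brinon–Conrad 6.3.8,
PROVED in the tree).  Hence (`isIrreducible_restrictField_of_not_solvablyReducible`) T_Π follows from the two functorialities in their
IRREDUCIBLE form — `r` irreducible geometric with a `Sym² ⊗ χ` (resp. `⊠`) shadow whose pieces are weakly automorphic ⇒ `r` weakly automorphic —
which is Gelbart–Jacquet Thm (9.3) CUSPIDAL case (`GelbartJacquet_symmSq_cuspidal`; non-dihedral proviso ⟸ irreducibility of `Sym² σ`) resp.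
Ramakrishnan Thm M with its cuspidality criterion (`Ramakrishnan2000_theoremM`), each with the riders «L-algebraicity of the lift» and «Satake
parameters ↔ Frobenius polynomials of the shadow» (`stub_productDescentTransport_of_irreducibleTransport`).  Both irreducible-form hypotheses are
Langlands-implied (`symmSqTransportIrr_of_langlands`, `tensorTransportIrr_of_langlands`: direction (B) of the summit at the instance `r`).
No new definition; 0 sorry; standard axioms.
-/

set_option linter.dupNamespace false

namespace Summit.Langlands.Langlands.Theorems.CoreAdequacy.ExtAdequacy.ProductTransport

open Filter IsDedekindDomain NumberField
open scoped MatrixGroups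
open Literature.NumberTheory.GaloisRepresentations
open Literature.NumberTheory.Automorphic
open Literature.NumberTheory.PAdicHodge
open Summit.Langlands.Langlands.Theses
open Summit.Langlands.Langlands.Theorems.BrightMate (serre_of_worlds)
open Summit.Langlands.Langlands.Theorems.IrreducibleOffSector (isIrreducible_of_rank_one stub_frameDevissage stub_deRhamBlocks
  blocks_eq_one_of_eq_one charpoly_eq_mul_of_blocks exists_ne_bot_ne_top_of_not_isIrreducible)

/-! ## §1 Traces along a block triangular frame; rank-zero traces -/

/-- Traces ADD along a block upper triangular frame `P ψ P⁻¹ = reindex e e (A B; 0 D)`: `tr ψ(g) = tr A(g) + tr D(g)` (characteristic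
polynomials multiply, landed `charpoly_eq_mul_of_blocks`, and `tr = -nextCoeff (charpoly)`). [folklore] -/
theorem trace_eq_add_of_blocks {k : Type*} [CommRing k] [TopologicalSpace k] [IsTopologicalRing k]
    {G : Type*} [Group G] [TopologicalSpace G] {n m p : ℕ}
    (e : Fin m ⊕ Fin p ≃ Fin n) (P : GL (Fin n) k) (ψ : G →ₜ* GL (Fin n) k)
    (A : G →ₜ* GL (Fin m) k) (D : G →ₜ* GL (Fin p) k) (B : G → Matrix (Fin m) (Fin p) k)
    (hblock : ∀ g, ((FramedRep.conj P ψ g : GL (Fin n) k) : Matrix (Fin n) (Fin n) k) =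
      Matrix.reindex e e (Matrix.fromBlocks ((A g : GL (Fin m) k) : Matrix (Fin m) (Fin m) k)
        (B g) 0 ((D g : GL (Fin p) k) : Matrix (Fin p) (Fin p) k)))
    (g : G) : FramedRep.trace ψ g = FramedRep.trace A g + FramedRep.trace D g := by
  nontriviality k
  have h := charpoly_eq_mul_of_blocks e P ψ A D B hblock g
  simp only [FramedRep.trace, Matrix.trace_eq_neg_charpoly_nextCoeff]
  change -(FramedRep.charpoly ψ g).nextCoeff = -(FramedRep.charpoly A g).nextCoeff + -(FramedRep.charpoly D g).nextCoeff
  have hA : (FramedRep.charpoly A g).Monic := Matrix.charpoly_monic _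
  have hD : (FramedRep.charpoly D g).Monic := Matrix.charpoly_monic _
  rw [h, hA.nextCoeff_mul hD]
  ring

/-- A framed representation of rank `0` has trace `0`. [folklore] -/
theorem trace_of_rank_zero {G : Type*} [Group G] [TopologicalSpace G] {A : Type*} [CommRing A] [TopologicalSpace A]
    (θ : FramedRep G A 0) (g : G) : FramedRep.trace θ g = 0 := by
  simp [FramedRep.trace, Matrix.trace]

/-! ## §2 Every geometric `ρ` has an irreducible GEOMETRIC trace-constituent with a framed complement -/

/-- **Irreducible geometric trace-constituent with complement.**  Every geometric (`LieDefect.Geometric`: a.e. unramified, de Rham above `ℓ` for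
the pinned data) `r : Γ_E → GL_n(ℚ̄_ℓ)`, `0 < n`, over a number field `E` has an IRREDUCIBLE GEOMETRIC `ϑ : Γ_E → GL_m(ℚ̄_ℓ)` with `0 < m ≤ n` and
a framed `θc` with `tr r = tr ϑ + tr θc` on `Γ_E`; and `m < n` unless `r` is irreducible (then `ϑ = r`, `θc` of rank `0`).  Strong induction on
`n`: if `r` is reducible, dévissage along a proper non-zero stable subspace (landed `stub_frameDevissage`) gives `P r P⁻¹ = (A B; 0 D)` with `A`
of rank `0 < m < n`, unramified wherever `r` is (`blocks_eq_one_of_eq_one`) and de Rham above `ℓ` (`stub_deRhamBlocks`, the block form restricting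
to decomposition groups definitionally); the induction hypothesis on `A` gives `ϑ`, `θ'`, and `θc := θ' ⊞ D` (`FramedRep.blockSum`,
`trace_blockSum`).  Bourbaki A VIII § 20 n° 6; Fontaine–Mazur 1995 §1. [folklore] -/
theorem exists_irreducible_geometric_traceConstituent (E : Type) [Field E] [NumberField E] (ℓ : ℕ) [Fact ℓ.Prime] :
    ∀ (n : ℕ) (r : FramedGaloisRep E (PadicAlgCl ℓ) n), 0 < n → LieDefect.Geometric r →
      ∃ (m : ℕ) (ϑ : FramedGaloisRep E (PadicAlgCl ℓ) m) (mc : ℕ) (θc : FramedGaloisRep E (PadicAlgCl ℓ) mc),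
        0 < m ∧ m ≤ n ∧ (r.toGaloisRep.IsIrreducible ∨ m < n) ∧ ϑ.toGaloisRep.IsIrreducible ∧ LieDefect.Geometric ϑ ∧
          ∀ g : Field.absoluteGaloisGroup E, FramedRep.trace r g = FramedRep.trace ϑ g + FramedRep.trace θc g := by
  intro n
  induction n using Nat.strong_induction_on with
  | _ n ih =>
    intro r hn hgeo
    by_cases hirr : r.toGaloisRep.IsIrreducible
    · exact ⟨n, r, 0, (1 : FramedGaloisRep E (PadicAlgCl ℓ) 0), hn, le_rfl, Or.inl hirr, hirr, hgeo, fun g => by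
        rw [trace_of_rank_zero, add_zero]⟩
    -- dévissage along a proper non-zero stable subspace
    obtain ⟨W, hW0, hW1⟩ := exists_ne_bot_ne_top_of_not_isIrreducible r hn hirr
    obtain ⟨m, p, hmn, hpn, hm, hp, e, P, A, D, B, hblock⟩ := stub_frameDevissage r W hW0 hW1
    -- the block `A` is geometric: unramified wherever `r` is, de Rham above `ℓ`
    have hker : ∀ σ, r σ = 1 → A σ = 1 ∧ D σ = 1 := fun σ hσ =>
      blocks_eq_one_of_eq_one e P r A D B hblock hσ
    have hgeoA : LieDefect.Geometric A :=
      ⟨hgeo.1.mono fun v hv 𝔓 h𝔓 σ hσ => (hker σ (hv 𝔓 h𝔓 σ hσ)).1, fun v hv =>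
        (stub_deRhamBlocks (fontainePstAdicCompletion v ℓ hv) e P (r.toLocal v) (FramedGaloisRep.toLocal v A)
          (FramedGaloisRep.toLocal v D) (B ∘ absGaloisRestrict E (v.adicCompletion E)) (fun σ => hblock _) (hgeo.2 v hv)).1⟩
    -- induction hypothesis on `A`, complement `θ' ⊞ D`
    obtain ⟨m', ϑ, mc', θ', hm', hm'le, -, hϑirr, hϑgeo, htrA⟩ := ih m hmn A hm hgeoA
    refine ⟨m', ϑ, mc' + p, FramedRep.blockSum θ' D, hm', by omega, Or.inr (by omega), hϑirr, hϑgeo, fun g => ?_⟩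
    rw [trace_eq_add_of_blocks e P r A D B hblock g, htrA g, FramedRep.trace_blockSum, add_assoc]

/-- **¬SolvablyReducible ⇒ `ρ|_E` irreducible on every finite solvable Galois `E/K`** (for geometric `ρ`, `0 < n`).  `ρ|_E` is geometric
(landed `eventually_isUnramifiedAt_restrictField`; `isDeRhamFramed_toLocal_restrictField` with the tree's THEOREM `DeRhamBaseChange_holds`,
Brinon–Conrad Prop. 6.3.8), so by `exists_irreducible_geometric_traceConstituent` either it is irreducible or it has an irreducible geometric
trace-constituent of rank `0 < m < n` with complement — which is exactly a witness of `BrightMate.SolvablyReducible ρ` over `E`. -/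
theorem isIrreducible_restrictField_of_not_solvablyReducible {K : Type} [Field K] [NumberField K] {ℓ : ℕ} [Fact ℓ.Prime] {n : ℕ}
    (ρ : FramedGaloisRep K (PadicAlgCl ℓ) n) (hn : 0 < n) (hgeo : LieDefect.Geometric ρ) (hnsr : ¬ BrightMate.SolvablyReducible ρ)
    (E : Type) [Field E] [NumberField E] [Algebra K E] (hGal : IsGalois K E) (hSolv : IsSolvable (E ≃ₐ[K] E)) :
    (ρ.restrictField E).toGaloisRep.IsIrreducible := by
  have hgeoE : LieDefect.Geometric (ρ.restrictField E) :=
    ⟨FramedGaloisRep.eventually_isUnramifiedAt_restrictField ρ hgeo.1,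
      fun w hw => isDeRhamFramed_toLocal_restrictField DeRhamBaseChange_holds ρ hgeo.2 w hw⟩
  obtain ⟨m, ϑ, mc, θc, hm, -, hdisj, hϑirr, hϑgeo, htr⟩ :=
    exists_irreducible_geometric_traceConstituent E ℓ n (ρ.restrictField E) hn hgeoE
  refine hdisj.resolve_right fun hmn => hnsr ?_
  exact ⟨E, inferInstance, inferInstance, inferInstance, hGal, hSolv, m, ϑ, hmn, hm, hϑirr, hϑgeo, mc, θc, htr⟩

/-! ## §3 T_Π from the two functorialities in IRREDUCIBLE form -/

/-- **T_Π ⟸ {Sym² ⊗ χ transport (irreducible case), ⊠ transport (irreducible case)}.**  The registered stub VERBATIM from the two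
functorialities for IRREDUCIBLE geometric `r` — `hSymIrr`: `r` irreducible geometric, `2·tr r = tr χ·((tr σ)² + tr σ(g²))` with `σ` irreducible
geometric rank 2, `χ` geometric rank 1, both weakly automorphic over `E` ⇒ `r` weakly automorphic over `E` (Gelbart–Jacquet Thm (9.3), cuspidal
case, + GL₁-twist, in the weak-automorphy currency); `hTensorIrr`: the same for `tr r = tr σ₁ · tr σ₂` (Ramakrishnan Thm M with its cuspidality
criterion).  Proof: Serre_w(E) := OW ∧ RES; `E` and the shadow from the Π-binder; the pieces are weakly automorphic by the IH (`weakAut_of_liftBelow`,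
ranks 2, 1 < n = 3, 4); `ρ|_E` is irreducible by `isIrreducible_restrictField_of_not_solvablyReducible` (binder ¬SolvablyReducible, `ρ` geometric
by `LiftTail`'s own antecedent) and geometric; the hypothesis makes `ρ|_E` weakly automorphic over `E`; CSD with `ϑ := ρ|_E`, `m := n`, complement of
rank `0`, descends to `K`.  Idle binders: the image dials, `ℓ ≤ n`, ¬SolvablyMated, the link antecedent of `LiftTail`. -/
theorem stub_productDescentTransport_of_irreducibleTransport
    (hSymIrr : ∀ (E : Type) [Field E] [NumberField E] (n : ℕ) (ℓ : ℕ) [Fact ℓ.Prime] (ι : PadicAlgCl ℓ ≃+* ℂ)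
      (r : FramedGaloisRep E (PadicAlgCl ℓ) n) (σ : FramedGaloisRep E (PadicAlgCl ℓ) 2) (χ : FramedGaloisRep E (PadicAlgCl ℓ) 1),
      r.toGaloisRep.IsIrreducible → LieDefect.Geometric r → σ.toGaloisRep.IsIrreducible → LieDefect.Geometric σ → LieDefect.Geometric χ →
      (∀ g : Field.absoluteGaloisGroup E,
        2 * FramedRep.trace r g = FramedRep.trace χ g * (FramedRep.trace σ g ^ 2 + FramedRep.trace σ (g * g))) →
      (∀ hcpt₂ : isCompact_glFiniteIntegralLevel 2 E, ∃ π : CuspidalAutomorphicRepData 2 E hcpt₂, π.1.IsLAlgebraic ∧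
        ∀ᶠ v : HeightOneSpectrum (𝓞 E) in cofinite, SatakeFrobCompatibleAt ι π.1 σ v) →
      (∀ hcpt₁ : isCompact_glFiniteIntegralLevel 1 E, ∃ π : CuspidalAutomorphicRepData 1 E hcpt₁, π.1.IsLAlgebraic ∧
        ∀ᶠ v : HeightOneSpectrum (𝓞 E) in cofinite, SatakeFrobCompatibleAt ι π.1 χ v) →
      ∀ hcptE : isCompact_glFiniteIntegralLevel n E, ∃ π : CuspidalAutomorphicRepData n E hcptE, π.1.IsLAlgebraic ∧
        ∀ᶠ v : HeightOneSpectrum (𝓞 E) in cofinite, SatakeFrobCompatibleAt ι π.1 r v)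
    (hTensorIrr : ∀ (E : Type) [Field E] [NumberField E] (n : ℕ) (ℓ : ℕ) [Fact ℓ.Prime] (ι : PadicAlgCl ℓ ≃+* ℂ)
      (r : FramedGaloisRep E (PadicAlgCl ℓ) n) (σ₁ σ₂ : FramedGaloisRep E (PadicAlgCl ℓ) 2),
      r.toGaloisRep.IsIrreducible → LieDefect.Geometric r →
      σ₁.toGaloisRep.IsIrreducible → σ₂.toGaloisRep.IsIrreducible → LieDefect.Geometric σ₁ → LieDefect.Geometric σ₂ →
      (∀ g : Field.absoluteGaloisGroup E, FramedRep.trace r g = FramedRep.trace σ₁ g * FramedRep.trace σ₂ g) →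
      (∀ hcpt₂ : isCompact_glFiniteIntegralLevel 2 E, ∃ π : CuspidalAutomorphicRepData 2 E hcpt₂, π.1.IsLAlgebraic ∧
        ∀ᶠ v : HeightOneSpectrum (𝓞 E) in cofinite, SatakeFrobCompatibleAt ι π.1 σ₁ v) →
      (∀ hcpt₂ : isCompact_glFiniteIntegralLevel 2 E, ∃ π : CuspidalAutomorphicRepData 2 E hcpt₂, π.1.IsLAlgebraic ∧
        ∀ᶠ v : HeightOneSpectrum (𝓞 E) in cofinite, SatakeFrobCompatibleAt ι π.1 σ₂ v) →
      ∀ hcptE : isCompact_glFiniteIntegralLevel n E, ∃ π : CuspidalAutomorphicRepData n E hcptE, π.1.IsLAlgebraic ∧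
        ∀ᶠ v : HeightOneSpectrum (𝓞 E) in cofinite, SatakeFrobCompatibleAt ι π.1 r v) :
    ExtendedAdequacySplit.OdlyzkoWorldAutomorphy → ExtendedAdequacySplit.TransOdlyzkoAutomorphy →
      ExtendedAdequacySplit.SatakeAvatarExistence → ExtendedAdequacySplit.CliffordSolvableDescent →
        ExtendedAdequacySplit.CoreIrreducibleProductLifting := by
  intro hOW hRES hW hCSD K _ _ n hcpt hn ih ℓ _ ι ρ _ _ _ _ _ _ _ _ _ hprod hnsr _ hirr hgeo _
  have hS : ResidualSplit.ResidualAutomorphy := serre_of_worlds hOW hRES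
  obtain ⟨E, _, _, _, hGal, hSolv, hshadow⟩ := hprod
  -- ρ|_E is irreducible (¬SolvablyReducible) and geometric
  have hirrE : (ρ.restrictField E).toGaloisRep.IsIrreducible :=
    isIrreducible_restrictField_of_not_solvablyReducible ρ hn hgeo hnsr E hGal hSolv
  have hgeoE : LieDefect.Geometric (ρ.restrictField E) :=
    ⟨FramedGaloisRep.eventually_isUnramifiedAt_restrictField ρ hgeo.1,
      fun w hw => isDeRhamFramed_toLocal_restrictField DeRhamBaseChange_holds ρ hgeo.2 w hw⟩
  -- ρ|_E is weakly automorphic over E: pieces by the IH, then the functoriality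
  have hautE : ∀ hcptE : isCompact_glFiniteIntegralLevel n E, ∃ π : CuspidalAutomorphicRepData n E hcptE, π.1.IsLAlgebraic ∧
      ∀ᶠ v : HeightOneSpectrum (𝓞 E) in cofinite, SatakeFrobCompatibleAt ι π.1 (ρ.restrictField E) v := by
    rcases hshadow with ⟨σ, χ, hσirr, hσgeo, hχgeo, htr⟩ | ⟨σ₁, σ₂, h₁irr, h₂irr, h₁geo, h₂geo, htr⟩
    · have hn3 : n = 3 := ExtAdequacy.Product.rank_eq_three_of_symSq_shadow _ htr
      exact hSymIrr E n ℓ ι (ρ.restrictField E) σ χ hirrE hgeoE hσirr hσgeo hχgeo htr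
        (fun hcpt₂ => weakAut_of_liftBelow hS hW ih (by omega) two_pos E hcpt₂ ℓ ι σ hσirr hσgeo)
        (fun hcpt₁ => weakAut_of_liftBelow hS hW ih (by omega) one_pos E hcpt₁ ℓ ι χ (isIrreducible_of_rank_one χ) hχgeo)
    · have hn4 : n = 4 := ExtAdequacy.Product.rank_eq_four_of_tensor_shadow _ htr
      exact hTensorIrr E n ℓ ι (ρ.restrictField E) σ₁ σ₂ hirrE hgeoE h₁irr h₂irr h₁geo h₂geo htr
        (fun hcpt₂ => weakAut_of_liftBelow hS hW ih (by omega) two_pos E hcpt₂ ℓ ι σ₁ h₁irr h₁geo)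
        (fun hcpt₂ => weakAut_of_liftBelow hS hW ih (by omega) two_pos E hcpt₂ ℓ ι σ₂ h₂irr h₂geo)
  -- Clifford solvable descent E → K with ϑ := ρ|_E (complement of rank 0)
  exact hCSD hW K n ℓ ι ρ hirr hgeo hn E hGal hSolv n (ρ.restrictField E) hirrE
    ⟨0, (1 : FramedGaloisRep E (PadicAlgCl ℓ) 0), fun g => by rw [trace_of_rank_zero, add_zero]⟩ hn hautE hcpt

/-! ## §4 Necessity certificates: both irreducible-form functorialities are Langlands-implied (direction (B) at the instance `r`) -/

/-- Langlands ⟹ the irreducible-form `Sym² ⊗ χ` transport (only irreducibility and geometricity of `r` are used; `0 < n` from `n = 3`). -/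
theorem symmSqTransportIrr_of_langlands (hL : _root_.Langlands) :
    ∀ (E : Type) [Field E] [NumberField E] (n : ℕ) (ℓ : ℕ) [Fact ℓ.Prime] (ι : PadicAlgCl ℓ ≃+* ℂ)
      (r : FramedGaloisRep E (PadicAlgCl ℓ) n) (σ : FramedGaloisRep E (PadicAlgCl ℓ) 2) (χ : FramedGaloisRep E (PadicAlgCl ℓ) 1),
      r.toGaloisRep.IsIrreducible → LieDefect.Geometric r → σ.toGaloisRep.IsIrreducible → LieDefect.Geometric σ → LieDefect.Geometric χ →
      (∀ g : Field.absoluteGaloisGroup E,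
        2 * FramedRep.trace r g = FramedRep.trace χ g * (FramedRep.trace σ g ^ 2 + FramedRep.trace σ (g * g))) →
      (∀ hcpt₂ : isCompact_glFiniteIntegralLevel 2 E, ∃ π : CuspidalAutomorphicRepData 2 E hcpt₂, π.1.IsLAlgebraic ∧
        ∀ᶠ v : HeightOneSpectrum (𝓞 E) in cofinite, SatakeFrobCompatibleAt ι π.1 σ v) →
      (∀ hcpt₁ : isCompact_glFiniteIntegralLevel 1 E, ∃ π : CuspidalAutomorphicRepData 1 E hcpt₁, π.1.IsLAlgebraic ∧
        ∀ᶠ v : HeightOneSpectrum (𝓞 E) in cofinite, SatakeFrobCompatibleAt ι π.1 χ v) →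
      ∀ hcptE : isCompact_glFiniteIntegralLevel n E, ∃ π : CuspidalAutomorphicRepData n E hcptE, π.1.IsLAlgebraic ∧
        ∀ᶠ v : HeightOneSpectrum (𝓞 E) in cofinite, SatakeFrobCompatibleAt ι π.1 r v := by
  intro E _ _ n ℓ _ ι r σ χ hirr hgeo _ _ _ htr _ _ hcptE
  have hn : 0 < n := by rw [ExtAdequacy.Product.rank_eq_three_of_symSq_shadow _ htr]; norm_num
  obtain ⟨⟨𝓡⟩, h𝓡⟩ := hL E
  obtain ⟨π, hLπ, hcorr⟩ := (h𝓡 𝓡 n hn hcptE).2 ℓ ι r hirr hgeo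
  exact ⟨π, hLπ, hcorr.1⟩

/-- Langlands ⟹ the irreducible-form `⊠` transport (`0 < n` from `n = 4`). -/
theorem tensorTransportIrr_of_langlands (hL : _root_.Langlands) :
    ∀ (E : Type) [Field E] [NumberField E] (n : ℕ) (ℓ : ℕ) [Fact ℓ.Prime] (ι : PadicAlgCl ℓ ≃+* ℂ)
      (r : FramedGaloisRep E (PadicAlgCl ℓ) n) (σ₁ σ₂ : FramedGaloisRep E (PadicAlgCl ℓ) 2),
      r.toGaloisRep.IsIrreducible → LieDefect.Geometric r →
      σ₁.toGaloisRep.IsIrreducible → σ₂.toGaloisRep.IsIrreducible → LieDefect.Geometric σ₁ → LieDefect.Geometric σ₂ →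
      (∀ g : Field.absoluteGaloisGroup E, FramedRep.trace r g = FramedRep.trace σ₁ g * FramedRep.trace σ₂ g) →
      (∀ hcpt₂ : isCompact_glFiniteIntegralLevel 2 E, ∃ π : CuspidalAutomorphicRepData 2 E hcpt₂, π.1.IsLAlgebraic ∧
        ∀ᶠ v : HeightOneSpectrum (𝓞 E) in cofinite, SatakeFrobCompatibleAt ι π.1 σ₁ v) →
      (∀ hcpt₂ : isCompact_glFiniteIntegralLevel 2 E, ∃ π : CuspidalAutomorphicRepData 2 E hcpt₂, π.1.IsLAlgebraic ∧
        ∀ᶠ v : HeightOneSpectrum (𝓞 E) in cofinite, SatakeFrobCompatibleAt ι π.1 σ₂ v) →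
      ∀ hcptE : isCompact_glFiniteIntegralLevel n E, ∃ π : CuspidalAutomorphicRepData n E hcptE, π.1.IsLAlgebraic ∧
        ∀ᶠ v : HeightOneSpectrum (𝓞 E) in cofinite, SatakeFrobCompatibleAt ι π.1 r v := by
  intro E _ _ n ℓ _ ι r σ₁ σ₂ hirr hgeo _ _ _ _ htr _ _ hcptE
  have hn : 0 < n := by rw [ExtAdequacy.Product.rank_eq_four_of_tensor_shadow _ htr]; norm_num
  obtain ⟨⟨𝓡⟩, h𝓡⟩ := hL E
  obtain ⟨π, hLπ, hcorr⟩ := (h𝓡 𝓡 n hn hcptE).2 ℓ ι r hirr hgeo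
  exact ⟨π, hLπ, hcorr.1⟩

end Summit.Langlands.Langlands.Theorems.CoreAdequacy.ExtAdequacy.ProductTransport
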